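import Mathlib
import Summits.Ventures.PercRepro2.Defs
import Summits.Ventures.PercRepro2.Independence
import Summits.Ventures.PercRepro2.Harris
import Summits.Ventures.PercRepro2.Graph
import Summits.Ventures.PercRepro2.Exploration
import Summits.Ventures.PercRepro2.Events
import Summits.Ventures.PercRepro2.HCov
import Summits.Ventures.PercRepro2.HCovFns
import Summits.Ventures.PercRepro2.HCovSwap
import Summits.Ventures.PercRepro2.PendantRoot
import Summits.Ventures.PercRepro2.PendantO
import Summits.Ventures.PercRepro2.PendantB
import Summits.Ventures.PercRepro2.PendantBRow
import Summits.Ventures.PercRepro2.LeafStep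
import Summits.Ventures.PercRepro2.LeafStepT0
import Summits.Ventures.PercRepro2.LeafPlus
import Summits.Ventures.PercRepro2.LeafBernstein

/-!
# The c-line: (HCOV) at `v`, (Q1) and the sharp row (Q1′) are three points of one affine family
(blind cell PercRepro2, p1 g9; `proofs/P1-Q1CORE.md` §2′)

For a centring constant `c` put (law `P(·|Q)`, `ū = E_Q u`)

  `Φ(c) = Cov_Q(σ_b, σ_o − σ_v (u_o − c)) − E_Q[(1 − u_v)(u_b − ū_b)(u_o − c)]`.

`PhiC c = P(Q)³ · Φ(c)` below is its cleared form in the `HCov` atoms at `a₃ := v`. Facts: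

* `Φ` is AFFINE in `c` with slope `T₀(b, v)/P(Q)³ ≥ 0` (`PhiC_sub`: `PhiC c − PhiC c' = (c − c') · T₀(b, v)`);
* `Φ(γ) = Gc(v) / (D_v · P(Q)²)` with `γ = E_Q[u_o | v ∉ U] = D_o/D_v` — so (HCOV) at `v` is `Φ(γ) ≥ 0`
  (`PhiC_gamma`);
* `Φ(ū_o) = Q1val / (P(Q)⁴ · D_v)` — so (Q1) at `v` is `Φ(ū_o) ≥ 0` (`PhiC_ubar`);
* `Φ(γ′) = Q1′val / (P(Q)³ · m_v · D_v)` with `γ′ = E_Q[u_o | v ∈ U] = P(Q, o ∈ U, v ∈ U)/m_v` and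
  **`Q1′val := P(Q) · m_v · Gc(v) + CovC(o, v) · T₀(b, v)`** — the SHARP ROW (Q1′) is `Φ(γ′) ≥ 0`
  (`PhiC_gamma'`; census 0 / 5,288,220 and exact 0 / 1,260, `proofs/P1-Q1CORE.md` §2′).

Since `ū_o` is the convex combination `(1 − ū_v) γ + ū_v γ′`, the affine `Φ` gives
**`(HCOV)(v) ∧ (Q1′) ⟹ (Q1)`** (`Q1Row_of_HCov_of_Q1Prime`, proved directly from the cleared forms:
on `CovC ≥ 0` by (HCOV), on `CovC < 0` by (Q1′) and `P(Q) ≥ m_v`).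
-/

namespace Summit.Ventures.PercRepro2

open UnionCluster CovForm PendantRoot PendantO

namespace LeafStep

variable {V : Type*} {E : Type*} [Fintype E] [DecidableEq E] [Fintype V] [DecidableEq V]
  {R : Type*} [Field R] [LinearOrder R] [IsStrictOrderedRing R]

section Defs

variable (p : E → R) (ends : E → Sym2 V)

/-- **`PhiC c = P(Q)³ · Φ(c)`**, the cleared c-line functional in the `HCov` atoms at `a₃ := v`:
`P(Q)·[P(Q)·(E_bo − E_bvo + c·E_bv) + gap·(E_o − E_vo + c·E_v) − P(Q)·(PDbo − c·PDb) + m_b·(D_o − c·D_v)]`. -/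
noncomputable def PhiC (o a₁ a₂ v b : V) (c : R) : R :=
  prob p (avoidAll ends a₂ {a₁}) *
    (prob p (avoidAll ends a₂ {a₁}) *
        (EQbo p ends o a₁ a₂ b - EQb3o p ends o a₁ a₂ v b + c * EQb3 p ends a₁ a₂ v b) +
      gap p ends a₁ a₂ b * (EQo p ends o a₁ a₂ - EQ3o p ends o a₁ a₂ v + c * EQ3 p ends a₁ a₂ v) -
      prob p (avoidAll ends a₂ {a₁}) * (PDbo p ends o a₁ a₂ v b - c * PDb p ends a₁ a₂ v b) +
      mU p ends a₁ a₂ b * (Do p ends o a₁ a₂ v - c * prob p (PDEvent ends a₁ a₂ v)))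

/-- **Row (Q1′)** (the sharp member of the c-line): `0 ≤ P(Q) · m_v · Gc(o, b, a₃) + CovC(o, a₃) · T₀(b, a₃)`. -/
def Q1PrimeRow (o a₁ a₂ a₃ b : V) : Prop :=
  0 ≤ prob p (avoidAll ends a₂ {a₁}) * mU p ends a₁ a₂ a₃ * Gc p ends o a₁ a₂ a₃ b +
    covC p ends o a₁ a₂ a₃ * T0 p ends b a₁ a₂ a₃

end Defs

/-! ## The affine structure -/

section Affine

variable (p : E → R) (ends : E → Sym2 V)

omit [Fintype V] in
/-- **The slope of the c-line is `T₀(b, v)`**: `PhiC c − PhiC c' = (c − c') · T₀(b, v)`. -/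
theorem PhiC_sub (o a₁ a₂ v b : V) (c c' : R) :
    PhiC p ends o a₁ a₂ v b c - PhiC p ends o a₁ a₂ v b c' = (c - c') * T0 p ends b a₁ a₂ v := by
  unfold PhiC T0 mU mUU
  unfold EQbo EQb3 EQo EQ3 PDb Do
  rw [gap_eq_Q p ends a₁ a₂ b, gap_eq_Q p ends a₁ a₂ v]
  simp only [prob_PD_v p ends a₁ a₂ v, prob_T_v p ends a₁ a₂ v, prob_T'_v p ends a₁ a₂ v,
    prob_PD_inter_v p ends a₁ a₂ v, prob_T_inter_v p ends a₁ a₂ v, prob_T'_inter_v p ends a₁ a₂ v]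
  simp only [Set.inter_comm]
  ring

omit [Fintype V] [DecidableEq V] [LinearOrder R] [IsStrictOrderedRing R] in
/-- **(HCOV) is the point `c = γ = D_o / D_v`**: `D_v · PhiC γ = P(Q) · Gc(v)` (cleared of the quotient). -/
theorem PhiC_gamma (o a₁ a₂ v b : V) (hD : prob p (PDEvent ends a₁ a₂ v) ≠ 0) :
    prob p (PDEvent ends a₁ a₂ v) *
        PhiC p ends o a₁ a₂ v b (Do p ends o a₁ a₂ v / prob p (PDEvent ends a₁ a₂ v)) =
      prob p (avoidAll ends a₂ {a₁}) * Gc p ends o a₁ a₂ v b := by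
  unfold PhiC Gc DEF
  field_simp
  ring

omit [Fintype V] in
/-- **(Q1) is the point `c = ū_o = m_o / P(Q)`**:
`P(Q) · D_v · PhiC ū_o = P(Q)² · Gc(v) + CovC(o, v) · T₀(b, v)`. -/
theorem PhiC_ubar (o a₁ a₂ v b : V) (hP : prob p (avoidAll ends a₂ {a₁}) ≠ 0) :
    prob p (avoidAll ends a₂ {a₁}) * prob p (PDEvent ends a₁ a₂ v) *
        PhiC p ends o a₁ a₂ v b (mU p ends a₁ a₂ o / prob p (avoidAll ends a₂ {a₁})) =
      prob p (avoidAll ends a₂ {a₁}) ^ 2 * Gc p ends o a₁ a₂ v b +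
        covC p ends o a₁ a₂ v * T0 p ends b a₁ a₂ v := by
  unfold PhiC Gc DEF covC T0 mU mUU
  unfold EQbo EQb3 EQb3o EQo EQ3 EQ3o PDb PDbo Do
  rw [gap_eq_Q p ends a₁ a₂ b, gap_eq_Q p ends a₁ a₂ v]
  simp only [prob_PD_v p ends a₁ a₂ v, prob_T_v p ends a₁ a₂ v, prob_T'_v p ends a₁ a₂ v,
    prob_PD_inter_v p ends a₁ a₂ v, prob_T_inter_v p ends a₁ a₂ v, prob_T'_inter_v p ends a₁ a₂ v]
  simp only [Set.inter_comm, Set.inter_left_comm]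
  field_simp
  ring

omit [Fintype V] in
/-- **(Q1′) is the point `c = γ′ = P(Q, o ∈ U, v ∈ U) / m_v`**:
`m_v · D_v · PhiC γ′ = P(Q) · m_v · Gc(v) + CovC(o, v) · T₀(b, v)`. -/
theorem PhiC_gamma' (o a₁ a₂ v b : V) (hm : mU p ends a₁ a₂ v ≠ 0) :
    mU p ends a₁ a₂ v * prob p (PDEvent ends a₁ a₂ v) *
        PhiC p ends o a₁ a₂ v b (mUU p ends o a₁ a₂ v / mU p ends a₁ a₂ v) =
      prob p (avoidAll ends a₂ {a₁}) * mU p ends a₁ a₂ v * Gc p ends o a₁ a₂ v b +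
        covC p ends o a₁ a₂ v * T0 p ends b a₁ a₂ v := by
  unfold PhiC Gc DEF covC T0 mU mUU
  unfold EQbo EQb3 EQb3o EQo EQ3 EQ3o PDb PDbo Do
  rw [gap_eq_Q p ends a₁ a₂ b, gap_eq_Q p ends a₁ a₂ v]
  simp only [prob_PD_v p ends a₁ a₂ v, prob_T_v p ends a₁ a₂ v, prob_T'_v p ends a₁ a₂ v,
    prob_PD_inter_v p ends a₁ a₂ v, prob_T_inter_v p ends a₁ a₂ v, prob_T'_inter_v p ends a₁ a₂ v]
  simp only [Set.inter_comm, Set.inter_left_comm]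
  unfold mU at hm
  field_simp
  ring

end Affine

/-! ## (HCOV)(v) ∧ (Q1′) ⟹ (Q1) -/

section Sandwich

variable (p : E → R) (ends : E → Sym2 V)

/-- **The sandwich**: (HCOV) at `v` together with the sharp row (Q1′) gives (Q1) at `v`. -/
theorem Q1Row_of_HCov_of_Q1Prime (hp : IsProbVec p) (o a₁ a₂ v b : V)
    (h : HCov p ends o a₁ a₂ v b) (h' : Q1PrimeRow p ends o a₁ a₂ v b) :
    Q1Row p ends o a₁ a₂ v b := by
  unfold Q1Row
  unfold Q1PrimeRow at h'
  have hT := T0_nonneg p ends hp b a₁ a₂ v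
  have hG : 0 ≤ Gc p ends o a₁ a₂ v b := h
  have hP0 : 0 ≤ prob p (avoidAll ends a₂ {a₁}) := prob_nonneg hp _
  have hmv := mU_le_prob_Q p ends hp a₁ a₂ v
  have hm0 : 0 ≤ mU p ends a₁ a₂ v := by
    unfold mU; exact add_nonneg (prob_nonneg hp _) (prob_nonneg hp _)
  by_cases hc : 0 ≤ covC p ends o a₁ a₂ v
  · have h1 : 0 ≤ prob p (avoidAll ends a₂ {a₁}) ^ 2 * Gc p ends o a₁ a₂ v b :=
      mul_nonneg (sq_nonneg _) hG
    have h2 : 0 ≤ covC p ends o a₁ a₂ v * T0 p ends b a₁ a₂ v := mul_nonneg hc hT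
    linarith
  · -- `P(Q)² · Gc ≥ P(Q) · m_v · Gc` since `P(Q) ≥ m_v ≥ 0` and `Gc ≥ 0`
    have h3 : prob p (avoidAll ends a₂ {a₁}) * mU p ends a₁ a₂ v * Gc p ends o a₁ a₂ v b ≤
        prob p (avoidAll ends a₂ {a₁}) ^ 2 * Gc p ends o a₁ a₂ v b := by
      have : prob p (avoidAll ends a₂ {a₁}) * mU p ends a₁ a₂ v ≤
          prob p (avoidAll ends a₂ {a₁}) ^ 2 := by nlinarith
      exact mul_le_mul_of_nonneg_right this hG
    linarith

end Sandwich

/-! ## The sharp row is leaf-closed by itself -/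

section LeafClosure

variable (p : E → R) (ends : E → Sym2 V)

omit [Fintype V] [DecidableEq V] [LinearOrder R] [IsStrictOrderedRing R] in
/-- `m_U(a₃) = q · m_U(v)` for a leaf `a₃` at `v`. -/
theorem mU_leaf {f : E} {a₃ v : V} (hf : ends f = s(a₃, v)) (hleaf : ∀ e, a₃ ∈ ends e → e = f)
    (h3v : a₃ ≠ v) {a₁ a₂ : V} (h31 : a₃ ≠ a₁) (h32 : a₃ ≠ a₂) :
    mU p ends a₁ a₂ a₃ = p f * mU p ends a₁ a₂ v := by
  unfold mU
  rw [prob_Q_conn₁_leaf' p ends hf hleaf h3v h31 h32, prob_Q_conn₂_leaf' p ends hf hleaf h3v h31 h32]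
  ring

omit [Fintype V] in
/-- **(Q1′) in the Bernstein coefficients**: `Q1′val = P(Q) · D_v · (2R½ − Gc(v)) − D_v² · T₀`, so (Q1′)
at `v` says `2 · R½ ≥ (D_v/P(Q)) · T₀ + Gc(v)`. -/
theorem Q1Prime_eq_Rhalf (o a₁ a₂ v b : V) :
    prob p (avoidAll ends a₂ {a₁}) * mU p ends a₁ a₂ v * Gc p ends o a₁ a₂ v b +
        covC p ends o a₁ a₂ v * T0 p ends b a₁ a₂ v =
      prob p (avoidAll ends a₂ {a₁}) * prob p (PDEvent ends a₁ a₂ v) *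
          (2 * Rhalf p ends o a₁ a₂ v b - Gc p ends o a₁ a₂ v b) -
        prob p (PDEvent ends a₁ a₂ v) ^ 2 * T0 p ends o a₁ a₂ b := by
  have hid := Rhalf_pole_identity p ends o a₁ a₂ v b
  have hPD := prob_PD_v p ends a₁ a₂ v
  unfold mU
  linear_combination -hid + prob p (avoidAll ends a₂ {a₁}) * Gc p ends o a₁ a₂ v b * hPD

/-- (Q1′) at `v` with `D_v > 0` gives `2 · R½ ≥ Gc(v) + (D_v/P(Q)) · T₀`; in particular `2 · R½ ≥ Gc(v)`. -/
theorem two_Rhalf_ge_of_Q1Prime (hp : IsProbVec p) (o a₁ a₂ v b : V)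
    (hD : 0 < prob p (PDEvent ends a₁ a₂ v)) (h' : Q1PrimeRow p ends o a₁ a₂ v b) :
    Gc p ends o a₁ a₂ v b ≤ 2 * Rhalf p ends o a₁ a₂ v b := by
  unfold Q1PrimeRow at h'
  rw [Q1Prime_eq_Rhalf] at h'
  have hP : 0 < prob p (avoidAll ends a₂ {a₁}) :=
    lt_of_lt_of_le hD (prob_mono hp (PDEvent_subset_Q ends a₁ a₂ v))
  have hT := T0_nonneg p ends hp o a₁ a₂ b
  have hpos : 0 < prob p (avoidAll ends a₂ {a₁}) * prob p (PDEvent ends a₁ a₂ v) := by positivity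
  have h1 : 0 ≤ prob p (PDEvent ends a₁ a₂ v) ^ 2 * T0 p ends o a₁ a₂ b :=
    mul_nonneg (sq_nonneg _) hT
  have h2 : 0 ≤ prob p (avoidAll ends a₂ {a₁}) * prob p (PDEvent ends a₁ a₂ v) *
      (2 * Rhalf p ends o a₁ a₂ v b - Gc p ends o a₁ a₂ v b) := by linarith
  have := (mul_nonneg_iff_of_pos_left hpos).1 h2
  linarith

/-- **(Q1′) propagates to a leaf by itself**: (Q1′) at the marker `v` (with `D_v > 0`) gives (Q1′) at a
leaf `a₃` attached to `v`, for every leaf weight — no (HCOV) needed. -/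
theorem Q1PrimeRow_leaf (hp : IsProbVec p) {f : E} {a₃ v : V} (hf : ends f = s(a₃, v))
    (hleaf : ∀ e, a₃ ∈ ends e → e = f) (h3v : a₃ ≠ v) {o a₁ a₂ b : V} (h31 : a₃ ≠ a₁)
    (h32 : a₃ ≠ a₂) (ho : o ≠ a₃) (hb : b ≠ a₃) (hD : 0 < prob p (PDEvent ends a₁ a₂ v))
    (h' : Q1PrimeRow p ends o a₁ a₂ v b) :
    Q1PrimeRow p ends o a₁ a₂ a₃ b := by
  have hR := two_Rhalf_ge_of_Q1Prime p ends hp o a₁ a₂ v b hD h'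
  have hT0 := T0_nonneg p ends hp o a₁ a₂ b
  unfold Q1PrimeRow at h' ⊢
  rw [Gc_leaf p ends hf hleaf h3v h31 h32 ho hb, covC_leaf p ends hf hleaf h3v h31 h32 ho,
    T0_leaf p ends hf hleaf h3v h31 h32 hb, mU_leaf p ends hf hleaf h3v h31 h32]
  have hq0 := hp.nonneg f
  have h1q : 0 ≤ 1 - p f := sub_nonneg.2 (hp.le_one f)
  have hP0 : 0 ≤ prob p (avoidAll ends a₂ {a₁}) := prob_nonneg hp _
  have hm0 : 0 ≤ mU p ends a₁ a₂ v := by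
    unfold mU; exact add_nonneg (prob_nonneg hp _) (prob_nonneg hp _)
  -- the decomposition `q(1−q)·P·m_v·[(1−q)T₀ + q(2R½ − Gc(v))] + q²·Q1′val`
  have e : prob p (avoidAll ends a₂ {a₁}) * (p f * mU p ends a₁ a₂ v) *
        ((1 - p f) ^ 2 * T0 p ends o a₁ a₂ b + 2 * p f * (1 - p f) * Rhalf p ends o a₁ a₂ v b +
          p f ^ 2 * Gc p ends o a₁ a₂ v b) +
      p f * covC p ends o a₁ a₂ v * (p f * T0 p ends b a₁ a₂ v) =
    p f * (1 - p f) * (prob p (avoidAll ends a₂ {a₁}) * mU p ends a₁ a₂ v) *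
        ((1 - p f) * T0 p ends o a₁ a₂ b +
          p f * (2 * Rhalf p ends o a₁ a₂ v b - Gc p ends o a₁ a₂ v b)) +
      p f ^ 2 * (prob p (avoidAll ends a₂ {a₁}) * mU p ends a₁ a₂ v * Gc p ends o a₁ a₂ v b +
        covC p ends o a₁ a₂ v * T0 p ends b a₁ a₂ v) := by ring
  rw [e]
  have t1 : 0 ≤ p f * (1 - p f) * (prob p (avoidAll ends a₂ {a₁}) * mU p ends a₁ a₂ v) :=
    mul_nonneg (mul_nonneg hq0 h1q) (mul_nonneg hP0 hm0)
  have t2 : 0 ≤ (1 - p f) * T0 p ends o a₁ a₂ b +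
      p f * (2 * Rhalf p ends o a₁ a₂ v b - Gc p ends o a₁ a₂ v b) :=
    add_nonneg (mul_nonneg h1q hT0) (mul_nonneg hq0 (by linarith))
  exact add_nonneg (mul_nonneg t1 t2) (mul_nonneg (sq_nonneg _) h')

/-- **THE SHARP LEAF CLOSURE**: `(HCOV) ∧ (Q1′)` at the marker `v` (with `D_v > 0`) gives
`(HCOV) ∧ (Q1′)` at a leaf `a₃` attached to `v`, for every leaf weight, and the leaf row `0 ≤ R½`
at `v` on the way; it implies g8's `HCovPlus` (`Q1Row_of_HCov_of_Q1Prime`). -/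
theorem HCovPrime_leaf (hp : IsProbVec p) {f : E} {a₃ v : V} (hf : ends f = s(a₃, v))
    (hleaf : ∀ e, a₃ ∈ ends e → e = f) (h3v : a₃ ≠ v) {o a₁ a₂ b : V} (h31 : a₃ ≠ a₁)
    (h32 : a₃ ≠ a₂) (ho : o ≠ a₃) (hb : b ≠ a₃) (hD : 0 < prob p (PDEvent ends a₁ a₂ v))
    (hH : HCov p ends o a₁ a₂ v b) (h' : Q1PrimeRow p ends o a₁ a₂ v b) :
    (HCov p ends o a₁ a₂ a₃ b ∧ Q1PrimeRow p ends o a₁ a₂ a₃ b) ∧ LeafRow p ends o a₁ a₂ v b := by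
  have hR := two_Rhalf_ge_of_Q1Prime p ends hp o a₁ a₂ v b hD h'
  have hrow : LeafRow p ends o a₁ a₂ v b := by
    unfold LeafRow
    have hG : 0 ≤ Gc p ends o a₁ a₂ v b := hH
    linarith
  exact ⟨⟨HCov_leaf p ends hp hf hleaf h3v h31 h32 ho hb hH hrow,
    Q1PrimeRow_leaf p ends hp hf hleaf h3v h31 h32 ho hb hD h'⟩, hrow⟩

end LeafClosure

/-! ## (Q1′) on the classes with `CovC(o, v) ≥ 0` -/

section Classes

variable (p : E → R) (ends : E → Sym2 V)

/-- (Q1′) at `v` follows from (HCOV) at `v` whenever `CovC(o, v) ≥ 0`. -/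
theorem Q1PrimeRow_of_HCov_of_covC_nonneg (hp : IsProbVec p) (o a₁ a₂ v b : V)
    (hc : 0 ≤ covC p ends o a₁ a₂ v) (h : HCov p ends o a₁ a₂ v b) :
    Q1PrimeRow p ends o a₁ a₂ v b := by
  unfold Q1PrimeRow
  have hT := T0_nonneg p ends hp b a₁ a₂ v
  have hP0 : 0 ≤ prob p (avoidAll ends a₂ {a₁}) := prob_nonneg hp _
  have hm0 : 0 ≤ mU p ends a₁ a₂ v := by
    unfold mU; exact add_nonneg (prob_nonneg hp _) (prob_nonneg hp _)
  have h1 : 0 ≤ prob p (avoidAll ends a₂ {a₁}) * mU p ends a₁ a₂ v * Gc p ends o a₁ a₂ v b :=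
    mul_nonneg (mul_nonneg hP0 hm0) h
  have h2 : 0 ≤ covC p ends o a₁ a₂ v * T0 p ends b a₁ a₂ v := mul_nonneg hc hT
  linarith

/-- **(A3-O)-type instances**: (HCOV) at `v` gives (Q1′) at `v` when `{o ∈ U} ⊆ {v ∈ U}` on `Q`. -/
theorem Q1PrimeRow_of_HCov_of_subset (hp : IsProbVec p) (o a₁ a₂ v b : V)
    (hsub : avoidAll ends a₂ {a₁} ∩ (connEvent ends a₁ o ∪ connEvent ends a₂ o) ⊆
      connEvent ends a₁ v ∪ connEvent ends a₂ v)
    (h : HCov p ends o a₁ a₂ v b) : Q1PrimeRow p ends o a₁ a₂ v b :=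
  Q1PrimeRow_of_HCov_of_covC_nonneg p ends hp o a₁ a₂ v b
    (covC_nonneg_of_subset p ends hp o a₁ a₂ v hsub) h

/-- **(ONE-ROOT)-type instances**: (HCOV) at `v` gives (Q1′) at `v` when `o, v` never lie in `C(a₁)` on `Q`. -/
theorem Q1PrimeRow_of_HCov_of_oneRoot (hp : IsProbVec p) (o a₁ a₂ v b : V)
    (ho : prob p (avoidAll ends a₂ {a₁} ∩ connEvent ends a₁ o) = 0)
    (hv : prob p (avoidAll ends a₂ {a₁} ∩ connEvent ends a₁ v) = 0)
    (h : HCov p ends o a₁ a₂ v b) : Q1PrimeRow p ends o a₁ a₂ v b :=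
  Q1PrimeRow_of_HCov_of_covC_nonneg p ends hp o a₁ a₂ v b
    (covC_nonneg_of_oneRoot p ends hp o a₁ a₂ v ho hv) h

end Classes

end LeafStep

end Summit.Ventures.PercRepro2
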